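import Mathlib.Analysis.InnerProductSpace.PiL2
import Mathlib.Analysis.Calculus.FDeriv.Symmetric
import Mathlib.Analysis.Calculus.ContDiff.Basic
import Mathlib.Analysis.Calculus.FDeriv.CompCLM
import HarnessLib

/-!
# Stub K0 `stub_hessian_apply_eq_zero_of_fderiv_identity` for crux `MoebiusLimitExists`
(stmt-CriticalPhenomena-1344), line `Sketch` v24
(lead prover-line-stmt-CriticalPhenomena-1344-c20-0; THEOREM-ONLY, `--supports stmt-CriticalPhenomena-1344`)

**The order-2 kernel produced by a first-order symmetry identity.**  Let `D : (ℝ³)ⁿ → ℝ` be `C²` at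
`x₀` with `fderiv ℝ D x₀ = 0`, and suppose that near `x₀` the derivative of `D` along the affine field
`y ↦ A y + c` is proportional to `D`, i.e. `fderiv ℝ D y (A y + c) = a * D y` eventually.  Then the
Hessian of `D` at `x₀` kills the direction `A x₀ + c` in either slot:
`iteratedFDeriv ℝ 2 D x₀ ![m, A x₀ + c] = 0` and `iteratedFDeriv ℝ 2 D x₀ ![A x₀ + c, m] = 0`.

Proof: differentiate `g y := fderiv ℝ D y (A y + c)` at `x₀` in two ways.  By the Leibniz rule for the
evaluation pairing (`HasFDerivAt.clm_apply`),
`fderiv g x₀ m = fderiv ℝ (fderiv ℝ D) x₀ m (A x₀ + c) + fderiv ℝ D x₀ (A m)`, whose second term vanishes.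
By the hypothesis `g` agrees near `x₀` with `y ↦ a * D y`, whose derivative at `x₀` is
`a • fderiv ℝ D x₀ = 0`.  Uniqueness of derivatives gives `fderiv ℝ (fderiv ℝ D) x₀ m (A x₀ + c) = 0`,
which is the first claim by `iteratedFDeriv_two_apply`; the second follows from the symmetry of second
derivatives of a real `C²` function (`ContDiffAt.isSymmSndFDerivAt`).  Pure calculus, Mathlib only; no
definitions are introduced.
-/

noncomputable section

namespace Summit.CriticalPhenomena.Ising3DConformalLimit.MoebiusLimitExistsSketchV24

open Filter Topology

/-- **Stub K0 — the order-2 kernel produced by a first-order symmetry identity.**  If `D` is `C²` at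
`x₀`, `fderiv ℝ D x₀ = 0`, and near `x₀` the first derivative along the affine field `y ↦ A y + c` is
proportional to `D` (`fderiv ℝ D y (A y + c) = a * D y`), then the Hessian of `D` at `x₀` kills the
direction `A x₀ + c` in either slot (differentiate the identity at `x₀` with `HasFDerivAt.clm_apply`,
compare with the derivative `a • fderiv ℝ D x₀ = 0` of the right-hand side, read off with
`iteratedFDeriv_two_apply`, and use the symmetry of second derivatives). [folklore] -/
theorem stub_hessian_apply_eq_zero_of_fderiv_identity : ∀ (n : ℕ) (D : (Fin n → EuclideanSpace ℝ (Fin 3)) → ℝ)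
    (x₀ : Fin n → EuclideanSpace ℝ (Fin 3))
    (A : (Fin n → EuclideanSpace ℝ (Fin 3)) →L[ℝ] (Fin n → EuclideanSpace ℝ (Fin 3)))
    (c : Fin n → EuclideanSpace ℝ (Fin 3)) (a : ℝ),
    ContDiffAt ℝ 2 D x₀ → fderiv ℝ D x₀ = 0 → (∀ᶠ y in 𝓝 x₀, fderiv ℝ D y (A y + c) = a * D y) →
    ∀ m : Fin n → EuclideanSpace ℝ (Fin 3),
      iteratedFDeriv ℝ 2 D x₀ ![m, A x₀ + c] = 0 ∧ iteratedFDeriv ℝ 2 D x₀ ![A x₀ + c, m] = 0 := by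
  intro n D x₀ A c a hD hD₁ hid m
  -- `fderiv ℝ D` is differentiable at `x₀` since `D` is `C²` there.
  have hdD : DifferentiableAt ℝ (fderiv ℝ D) x₀ :=
    (hD.fderiv_right (m := 1) le_rfl).differentiableAt one_ne_zero
  -- Leibniz rule for `g y := fderiv ℝ D y (A y + c)`.
  have hg : HasFDerivAt (fun y => fderiv ℝ D y (A y + c))
      ((fderiv ℝ D x₀).comp A + (fderiv ℝ (fderiv ℝ D) x₀).flip (A x₀ + c)) x₀ :=
    hdD.hasFDerivAt.clm_apply (A.hasFDerivAt.add_const c)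
  -- `g` agrees near `x₀` with `y ↦ a * D y`, whose derivative is `a • fderiv ℝ D x₀`.
  have hg' : HasFDerivAt (fun y => fderiv ℝ D y (A y + c)) (a • fderiv ℝ D x₀) x₀ :=
    ((hD.differentiableAt two_ne_zero).hasFDerivAt.const_mul a).congr_of_eventuallyEq hid
  have huniq := hg.unique hg'
  rw [hD₁] at huniq
  have key : fderiv ℝ (fderiv ℝ D) x₀ m (A x₀ + c) = 0 := by
    have h := congrArg (fun L : (Fin n → EuclideanSpace ℝ (Fin 3)) →L[ℝ] ℝ => L m) huniq
    simpa using h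
  have hsymm : IsSymmSndFDerivAt ℝ D x₀ := hD.isSymmSndFDerivAt (by simp)
  refine ⟨?_, ?_⟩
  · rw [iteratedFDeriv_two_apply]
    simpa using key
  · rw [iteratedFDeriv_two_apply, Matrix.cons_val_zero, Matrix.cons_val_one, Matrix.cons_val_fin_one,
      hsymm.eq (A x₀ + c) m]
    exact key

end Summit.CriticalPhenomena.Ising3DConformalLimit.MoebiusLimitExistsSketchV24

end
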